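import Summits.CriticalPhenomena.PercolationContinuityZ3.Theorems.Transplant.ThetaDropBoxProdZ2
import Summits.CriticalPhenomena.PercolationContinuityZ3.Theorems.Transplant.BoxProdZ2Tubes
import HarnessLib

/-!
# The typed top re-pointed to the DROP NODE (design (D) CONCENTRIC, lead V56): `ThetaDropBoxProdZ2 ⟹` Benjamini–Schramm's Conjecture 4 for EVERY `X □ ℤ²`,
# with NO side hypothesis (the tubes at `p_c` are subcritical by p3's Martineau–Severo instance `BoxProdZ2Tube.tubeSubcritical_criticalProb`, p211018)

builds on p205010 (kernel theorem, internal audit signed; external expert review pending) — nothing in this file uses p205010.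
Lane `prim-bschramm`, lead seat (gen 2); helper file (`--supports stmt-CriticalPhenomena-4575`).  Mirror of `bsConj4_boxProdZ2_of_prodNode` (BoxProdZ2Tubes)
for stmt-g4's weaker node `ThetaDropBoxProdZ2` ('θ(p) > 0 ∧ uniqueness ∧ TubeSubcritical ⇒ ∃ q < p, θ(q) > 0').
* **`bsConj4_boxProdZ2_of_dropNode : ThetaDropBoxProdZ2 → BSConj4_boxProdZ2`**.
[cite: BenjaminiSchramm1996, Conj. 4] [cite: MartineauSevero2019, Cor. 2.2] [cite: KozmaNitzan2024, §1 p. 2 (approach 1)]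
-/

noncomputable section

namespace Summit.CriticalPhenomena.PercolationContinuityZ3.Theorems.Transplant

open Literature.Probability.Percolation Literature.Probability.LatticeModels SimpleGraph

-- buildfix (DUP-FQN Summits set 095): the sibling module `Transplant/SamePWitnessPrime.lean` ALSO declares a constant
-- `Transplant.bsConj4_boxProdZ2_of_dropNode` (different statement), so no module — e.g. the `Summits` root aggregate — could import both.
-- The theorem below therefore lives in the sub-namespace `Transplant.DropTop` (declaration text unchanged) and is re-exported under its
-- old name as an ALIAS, so every importer's `bsConj4_boxProdZ2_of_dropNode` / `Transplant.bsConj4_boxProdZ2_of_dropNode` still resolves,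
-- while the two modules no longer define the same constant.
namespace DropTop

/-- **Benjamini–Schramm's Conjecture 4 for every `X □ ℤ²` from the DROP node alone** (tube hypothesis discharged by Martineau–Severo).
[cite: BenjaminiSchramm1996, Conj. 4] -/
theorem bsConj4_boxProdZ2_of_dropNode (hD : ThetaDropBoxProdZ2) : BSConj4_boxProdZ2 :=
  continuity_boxProdZ2_of_drop (fun X _ hc hq _ _ w => BoxProdZ2Tube.tubeSubcritical_criticalProb X hc hq w) hD

end DropTop

export DropTop (bsConj4_boxProdZ2_of_dropNode)

end Summit.CriticalPhenomena.PercolationContinuityZ3.Theorems.Transplant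

end
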